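import Summits.KontsevichZagierPeriods.KontsevichZagierPeriods.Theses.SymplecticScissors
import Literature.NumberTheory.Transcendental.AyoubPeriodSeries
import Literature.NumberTheory.Transcendental.AyoubPeriodSeriesKernel
import Literature.NumberTheory.Transcendental.AyoubPeriodSeriesPiAlgebraic
import Literature.NumberTheory.Transcendental.AyoubPeriodSeriesVariables
import Summits.KontsevichZagierPeriods.KontsevichZagierPeriods.Theorems.UnfoldedStokesStokesGenerationStubSpanToRepsAuxCoeff
import Mathlib.RingTheory.MvPowerSeries.Rename
import Mathlib.RingTheory.MvPowerSeries.Substitution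

/-!
# `TypeAGeneration` (stmt-KontsevichZagierPeriods-18392), line `Sketch`, stub `stub_rescalePiece`
(S5): the dilated piece `F((1−μ) zᵢ, w)` of the room step

Support file for the registered stub `stub_rescalePiece` of the crux `TypeAGeneration` (Ayoub 2015
Conj. 1.1, line `Sketch` = card stokes-compiler), on top of
`Literature/NumberTheory/Transcendental/AyoubPeriodSeries.lean`
(`AyoubRel.CSeries = ℂ[[z₀, z₁, …]]`, `AyoubRel.Oan σ = 𝒪_{k-alg}(𝔻̄^∞)`,
`AyoubRel.polyToCSeries σ : k[z] → ℂ[[z]]`, `AyoubRel.UsesVar`).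

For `F ∈ 𝒪_{k-alg}(𝔻̄^∞)`, anisotropic weights `ρ` summable for `F`, and a rational `0 < μ < 1`, the
dilation `D = F((1−μ) zᵢ, w) = MvPowerSeries.rescale (1[i ↦ 1−μ]) F` (coefficientwise
`D_a = (1−μ)^{aᵢ} F_a`, `s5_coeff_rescale`):

* lies in `𝒪_{k-alg}(𝔻̄^∞)` (`s5_rescale_mem_Oan`): same variables, same polyradius
  (`‖D_a‖ ≤ ‖F_a‖`), and algebraic over `k(z)` by transport of the relation along the automorphism
  `zᵢ ↦ (1−μ) zᵢ` of `k[z]`, which intertwines `polyToCSeries σ` with the (injective) dilation of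
  `ℂ[[z]]` (`s5_square`, `s5_rescale_injective`, `s5_isAlgebraic_rescale`);
* has the weights `ρ[i ↦ ρᵢ/(1−μ)]`, the two majorant families being EQUAL term by term
  (`s5_summable_rescale`);
* involves only variables of `F` (`s5_usesVar_of_rescale`).

No definition is introduced.
-/

noncomputable section

-- `Summit.KontsevichZagierPeriods.KontsevichZagierPeriods.…` is the tree's mandated layout (single-conjunct summit).
set_option linter.dupNamespace false

namespace Summit.KontsevichZagierPeriods.KontsevichZagierPeriods.TypeAGenerationLine

open Finsupp MvPowerSeries
open Literature.NumberTheory.Transcendental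
open Literature.NumberTheory.Transcendental.AyoubRel
open Summit.KontsevichZagierPeriods.KontsevichZagierPeriods.Theses.SymplecticScissors (TypeAGeneration)

/-! ## Coefficients of the dilation `zᵢ ↦ c zᵢ` -/

section Coeff

/-- The rescaling factor of `1[i ↦ c]` at the exponent `n` is `c ^ nᵢ` (all other factors are
`1 ^ m`). [folklore] -/
theorem s5_prod_update_one {M : Type*} [CommMonoid M] (i : ℕ) (c : M) (n : ℕ →₀ ℕ) :
    (n.prod fun s m => Function.update (1 : ℕ → M) i c s ^ m) = c ^ (n i) := by
  classical
  rw [Finsupp.prod, Finset.prod_eq_single i]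
  · rw [Function.update_self]
  · intro b _ hb
    rw [Function.update_of_ne hb, Pi.one_apply, one_pow]
  · intro hi
    rw [Finsupp.notMem_support_iff.mp hi, pow_zero]

/-- `coeff_a F(c zᵢ, w) = c^{aᵢ} coeff_a F`. [folklore] -/
theorem s5_coeff_rescale (i : ℕ) (c : ℂ) (F : CSeries) (n : ℕ →₀ ℕ) :
    coeff n (rescale (Function.update (1 : ℕ → ℂ) i c) F) = c ^ (n i) * coeff n F := by
  rw [coeff_rescale, s5_prod_update_one]

/-- The dilation `zᵢ ↦ c zᵢ` with `c ≠ 0` is injective on `ℂ[[z]]`. [folklore] -/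
theorem s5_rescale_injective (i : ℕ) {c : ℂ} (hc : c ≠ 0) :
    Function.Injective (rescale (Function.update (1 : ℕ → ℂ) i c) : CSeries → CSeries) := by
  intro G H h
  ext n
  have h' : coeff n (rescale (Function.update (1 : ℕ → ℂ) i c) G) =
      coeff n (rescale (Function.update (1 : ℕ → ℂ) i c) H) := by rw [h]
  rw [s5_coeff_rescale, s5_coeff_rescale] at h'
  exact mul_left_cancel₀ (pow_ne_zero _ hc) h'

/-- The dilation does not introduce variables: `coeff_a D ≠ 0 → coeff_a F ≠ 0`. [folklore] -/
theorem s5_usesVar_of_rescale {i : ℕ} {c : ℂ} {F : CSeries} {l : ℕ}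
    (h : UsesVar (rescale (Function.update (1 : ℕ → ℂ) i c) F) l) : UsesVar F l := by
  obtain ⟨a, hal, ha⟩ := h
  rw [s5_coeff_rescale] at ha
  exact ⟨a, hal, right_ne_zero_of_mul ha⟩

-- adapted from Literature/AlgebraicGeometry/Resolution/AlterationsNodalMonomialization.lean
/-- `rescale a` fixes the constants. [folklore] -/
theorem s5_rescale_C (a : ℕ → ℂ) (r : ℂ) : rescale a (C r : CSeries) = C r := by
  classical
  ext n
  rw [coeff_rescale, coeff_C]
  split_ifs with h
  · subst h
    rw [Finsupp.prod_zero_index, one_mul]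
  · rw [mul_zero]

-- adapted from Literature/AlgebraicGeometry/Resolution/AlterationsNodalMonomialization.lean
/-- `rescale a (zₗ) = a l · zₗ`. [folklore] -/
theorem s5_rescale_X (a : ℕ → ℂ) (l : ℕ) : rescale a (X l : CSeries) = C (a l) * X l := by
  classical
  ext n
  rw [coeff_rescale, coeff_C_mul, coeff_X]
  split_ifs with h
  · subst h
    rw [Finsupp.prod_single_index, pow_one, mul_one]
    exact pow_zero _
  · rw [mul_zero, mul_zero]

end Coeff

/-! ## Weights: `‖D_a‖ ρ'^a = ‖F_a‖ ρ^a` for `ρ' = ρ[i ↦ ρᵢ/(1−μ)]` -/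

section Weights

/-- Splitting off the `i`-th factor of a monomial weight. [folklore] -/
theorem s5_prod_pow_split {M : Type*} [CommMonoid M] (f : ℕ → M) (i : ℕ) (a : ℕ →₀ ℕ) :
    (a.prod fun l n => f l ^ n) = f i ^ (a i) * ∏ l ∈ a.support.erase i, f l ^ (a l) := by
  classical
  rw [Finsupp.prod]
  by_cases hi : i ∈ a.support
  · exact (Finset.mul_prod_erase a.support (fun l => f l ^ a l) hi).symm
  · rw [Finset.erase_eq_of_notMem hi, Finsupp.notMem_support_iff.mp hi, pow_zero, one_mul]

/-- `ρ'^a · λ^{aᵢ} = ρ^a` for `ρ' = ρ[i ↦ ρᵢ/λ]`, `λ ≠ 0`. [folklore] -/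
theorem s5_prod_update_div (ρ : ℕ → ℝ) (i : ℕ) (a : ℕ →₀ ℕ) {t : ℝ} (ht : t ≠ 0) :
    (a.prod fun l n => Function.update ρ i (ρ i / t) l ^ n) * t ^ (a i) =
      a.prod fun l n => ρ l ^ n := by
  rw [s5_prod_pow_split _ i, s5_prod_pow_split ρ i, Function.update_self]
  have h : ∏ l ∈ a.support.erase i, Function.update ρ i (ρ i / t) l ^ (a l) =
      ∏ l ∈ a.support.erase i, ρ l ^ (a l) :=
    Finset.prod_congr rfl fun l hl => by rw [Function.update_of_ne (Finset.ne_of_mem_erase hl)]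
  rw [h, mul_right_comm, ← mul_pow, div_mul_cancel₀ _ ht]

/-- `‖(1 − μ : ℚ)‖_ℂ = 1 − μ` for `μ < 1`. [folklore] -/
theorem s5_norm_lam (μ : ℚ) (hμ1 : μ < 1) : ‖((1 - μ : ℚ) : ℂ)‖ = 1 - (μ : ℝ) := by
  rw [Complex.norm_ratCast, Rat.cast_sub, Rat.cast_one, abs_of_pos]
  exact sub_pos.mpr (by exact_mod_cast hμ1)

/-- **Weights of the dilated piece** (an equality of majorant families):
`‖D_a‖ (ρ[i ↦ ρᵢ/(1−μ)])^a = ‖F_a‖ ρ^a`. [folklore] -/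
theorem s5_summable_rescale (ρ : ℕ → ℝ) {F : CSeries}
    (hsum : Summable (fun a : ℕ →₀ ℕ => ‖coeff a F‖ * a.prod fun l n => ρ l ^ n))
    (i : ℕ) (μ : ℚ) (hμ1 : μ < 1) :
    Summable (fun a : ℕ →₀ ℕ =>
      ‖coeff a (rescale (Function.update (1 : ℕ → ℂ) i ((1 - μ : ℚ) : ℂ)) F)‖ *
        a.prod fun l n => (Function.update ρ i (ρ i / (1 - (μ : ℝ)))) l ^ n) := by
  have ht : (1 - (μ : ℝ)) ≠ 0 := (sub_pos.mpr (by exact_mod_cast hμ1)).ne'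
  refine hsum.congr fun a => ?_
  rw [s5_coeff_rescale, norm_mul, norm_pow, s5_norm_lam μ hμ1, ← s5_prod_update_div ρ i a ht]
  ring

end Weights

/-! ## Algebraicity: transport along `zᵢ ↦ (1−μ) zᵢ` -/

section Algebraic

variable {k : Type} [Field k] (σ : k →+* ℂ)

/-- `polyToCSeries σ (C r) = C (σ r)`. [folklore] -/
theorem s5_polyToCSeries_C (r : k) : polyToCSeries σ (MvPolynomial.C r) = (C (σ r) : CSeries) := by
  simp [polyToCSeries, MvPolynomial.coe_C]

/-- `polyToCSeries σ (X l) = z_l`. [folklore] -/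
theorem s5_polyToCSeries_X (l : ℕ) : polyToCSeries σ (MvPolynomial.X l) = (X l : CSeries) := by
  simp [polyToCSeries, MvPolynomial.coe_X]

/-- `σ` carries the scaling vector `1[i ↦ 1−μ]` of `k` to that of `ℂ`. [folklore] -/
theorem s5_sigma_update (i : ℕ) (μ : ℚ) (l : ℕ) :
    σ (Function.update (1 : ℕ → k) i ((1 - μ : ℚ) : k) l) =
      Function.update (1 : ℕ → ℂ) i ((1 - μ : ℚ) : ℂ) l := by
  rcases eq_or_ne l i with rfl | h
  · rw [Function.update_self, Function.update_self, map_ratCast]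
  · rw [Function.update_of_ne h, Function.update_of_ne h, Pi.one_apply, Pi.one_apply, map_one]

/-- **The intertwining square**: `polyToCSeries σ ∘ (zᵢ ↦ (1−μ) zᵢ on k[z]) =
(zᵢ ↦ (1−μ) zᵢ on ℂ[[z]]) ∘ polyToCSeries σ`. [folklore] -/
theorem s5_square (i : ℕ) (μ : ℚ) :
    (polyToCSeries σ).comp (MvPolynomial.eval₂Hom MvPolynomial.C
        (fun l => MvPolynomial.C (Function.update (1 : ℕ → k) i ((1 - μ : ℚ) : k) l) *
          MvPolynomial.X l)) =
      (rescale (Function.update (1 : ℕ → ℂ) i ((1 - μ : ℚ) : ℂ))).comp (polyToCSeries σ) := by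
  refine MvPolynomial.ringHom_ext (fun r => ?_) (fun l => ?_)
  · rw [RingHom.comp_apply, RingHom.comp_apply, MvPolynomial.eval₂Hom_C, s5_polyToCSeries_C,
      s5_rescale_C]
  · rw [RingHom.comp_apply, RingHom.comp_apply, MvPolynomial.eval₂Hom_X', map_mul,
      s5_polyToCSeries_C, s5_polyToCSeries_X, s5_rescale_X, s5_sigma_update]

/-- **Algebraicity of the dilated piece**: if `P(z, F) = 0` with `P ∈ k[z][Y]` non-zero, then
`P^f(z, D) = 0` where `f : zᵢ ↦ (1−μ) zᵢ` is an injective endomorphism of `k[z]`. [folklore] -/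
theorem s5_isAlgebraic_rescale {F : CSeries} (halg : IsAlgebraicOverRatFunc σ F) (i : ℕ) (μ : ℚ)
    (hμ1 : μ < 1) :
    IsAlgebraicOverRatFunc σ (rescale (Function.update (1 : ℕ → ℂ) i ((1 - μ : ℚ) : ℂ)) F) := by
  obtain ⟨P, hP0, hP⟩ := halg
  have hsq := s5_square σ i μ
  have hc : ((1 - μ : ℚ) : ℂ) ≠ 0 := by exact_mod_cast (sub_pos.mpr hμ1).ne'
  have hg := s5_rescale_injective i hc
  have hfi : Function.Injective (MvPolynomial.eval₂Hom MvPolynomial.C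
      (fun l => MvPolynomial.C (Function.update (1 : ℕ → k) i ((1 - μ : ℚ) : k) l) *
        MvPolynomial.X l)) := by
    intro p q hpq
    apply polyToCSeries_injective σ
    apply hg
    have h1 := RingHom.congr_fun hsq p
    have h2 := RingHom.congr_fun hsq q
    rw [RingHom.comp_apply, RingHom.comp_apply] at h1 h2
    rw [← h1, ← h2, hpq]
  refine ⟨P.map _, (Polynomial.map_ne_zero_iff hfi).mpr hP0, ?_⟩
  rw [Polynomial.eval₂_map, hsq, ← Polynomial.hom_eval₂, hP, map_zero]

/-- **The dilated piece lies in `𝒪_{k-alg}(𝔻̄^∞)`** (same variables, same polyradius since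
`‖D_a‖ ≤ ‖F_a‖`, algebraic by transport). [folklore] -/
theorem s5_rescale_mem_Oan {F : CSeries} (hF : F ∈ Oan σ) (i : ℕ) (μ : ℚ) (hμ0 : 0 < μ)
    (hμ1 : μ < 1) : rescale (Function.update (1 : ℕ → ℂ) i ((1 - μ : ℚ) : ℂ)) F ∈ Oan σ := by
  obtain ⟨⟨m, hm⟩, ⟨r, hr, hs⟩, halg⟩ := hF
  have hr0 : 0 ≤ r := zero_le_one.trans hr.le
  refine ⟨⟨m, fun a ha => ?_⟩, ⟨r, hr, ?_⟩, s5_isAlgebraic_rescale σ halg i μ hμ1⟩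
  · rw [s5_coeff_rescale, hm a ha, mul_zero]
  · refine Summable.of_nonneg_of_le (fun a => mul_nonneg (norm_nonneg _) (pow_nonneg hr0 _))
      (fun a => ?_) hs
    rw [s5_coeff_rescale, norm_mul, norm_pow, s5_norm_lam μ hμ1]
    refine mul_le_mul_of_nonneg_right ?_ (pow_nonneg hr0 _)
    refine mul_le_of_le_one_left (norm_nonneg _) (pow_le_one₀ ?_ ?_)
    · exact sub_nonneg.mpr (by exact_mod_cast hμ1.le)
    · exact sub_le_self _ (by exact_mod_cast hμ0.le)

end Algebraic

/-! ## The registered stub -/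

/-- **S5 — the dilated piece.** For `F ∈ 𝒪_{k-alg}(𝔻̄^∞)` with anisotropic weights `ρ` and a
rational `0 < μ < 1`, the dilation `F((1−μ) zᵢ, w)` (`MvPowerSeries.rescale`, coefficientwise
`(1−μ)^{aᵢ} F_a`) lies in `𝒪_{k-alg}(𝔻̄^∞)` (algebraic by transport along the automorphism
`zᵢ ↦ (1−μ) zᵢ` of `k[z]`), has the weights `ρ[i ↦ ρᵢ/(1−μ)]` (an equality of majorants), and
involves only variables of `F`. [folklore] -/
theorem stub_rescalePiece :
    ∀ (k : Type) [Field k] [CharZero k] (σ : k →+* ℂ) (F : CSeries), F ∈ Oan σ →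
      ∀ (ρ : ℕ → ℝ), (∀ l, 1 < ρ l) →
        Summable (fun a : ℕ →₀ ℕ => ‖MvPowerSeries.coeff a F‖ * a.prod fun l n => ρ l ^ n) →
      ∀ (i : ℕ) (μ : ℚ), 0 < μ → μ < 1 →
        MvPowerSeries.rescale (Function.update (1 : ℕ → ℂ) i ((1 - μ : ℚ) : ℂ)) F ∈ Oan σ ∧
        Summable (fun a : ℕ →₀ ℕ =>
          ‖MvPowerSeries.coeff a (MvPowerSeries.rescale (Function.update (1 : ℕ → ℂ) i ((1 - μ : ℚ) : ℂ)) F)‖ *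
            a.prod fun l n => (Function.update ρ i (ρ i / (1 - (μ : ℝ)))) l ^ n) ∧
        (∀ l : ℕ, UsesVar (MvPowerSeries.rescale (Function.update (1 : ℕ → ℂ) i ((1 - μ : ℚ) : ℂ)) F) l →
          UsesVar F l) := by
  intro k _ _ σ F hF ρ _ hsum i μ hμ0 hμ1
  exact ⟨s5_rescale_mem_Oan σ hF i μ hμ0 hμ1, s5_summable_rescale ρ hsum i μ hμ1,
    fun l hl => s5_usesVar_of_rescale hl⟩

end Summit.KontsevichZagierPeriods.KontsevichZagierPeriods.TypeAGenerationLine
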